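import Literature.MathematicalPhysics.QuantumFieldTheory.Balaban1983to89.T4FlagMemory

/-!
# Spine/NE4/ScaleShiftFrozenHistory — GIVEN node U2's memory companion, NE4 reduces to its FROZEN-PREFIX form, and a
# frozen-prefix bound «gain θ₀ per frozen step × loss Λ per live step» with ANY finite loss Λ already gives `ScaleShiftRate` — no
# threshold couples the loss to the memory rate (cell `pub-balaban-gaps`, seat ne4, generation 20; census item (R63) of
# `HOME/ne/NE4.md` §5; companion `Spine/NE4/ScaleShiftFrozenOrbit.lean` renders it on the autonomous road of (R42))

HONEST FRAMING.  Bookkeeping for rung (B)+1 on ONE FIXED finite four-torus — NOT ℝ⁴, NOT infinite volume, NOT a mass gap, NOT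
Clay.  NE4 = `T4CouplingMatching.ScaleShiftRate` is NOT PRINTED ([Balaban1987RG1] p. 264 «We will investigate other properties in
a separate paper») and NOT PROVED here; spine estimates proved 0∕9, unchanged.  Every hypothesis on `β` is an UNPRINTED input;
nothing of Bałaban's is instantiated or asserted.  0 sorry.

WHAT.  Node U2 consumes the TRIPLE `ScaleShiftRate c θ γ β ∧ HistLipschitz Λ γ β ∧ FadingMemory C ω Λ`
(`T4CouplingMatching.disc_le_of_fadingMemory`).  Generation 19 (`Spine/NE4/ScaleShiftBareCorner.lean`) used ONE column of the third
member to slide the bare coupling `g_0` to the asymptotically free corner.  Here ALL columns are used: the oldest `m+1` couplings of a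
history of length `k+2` may be FROZEN at one common value `ε ∈ ]0,γ]` (e.g. `ε → 0⁺`) at the price `C·γ·ω^{k+1−m}∕(1−ω)` (§1,
`abs_sub_frz_le`), and likewise the oldest `m` couplings of its tail.  Hence (§2, `shift_le_frozen`) for EVERY `m ≤ k+1`

  `|β_{k+2}(w) − β_{k+1}(tail w)| ≤ 2Cγω^{k+1−m}∕(1−ω) + |β_{k+2}(ε,…,ε, w_{m+1},…,w_{k+1}) − β_{k+1}(ε,…,ε, w_{m+1},…,w_{k+1})|`

(`m+1` resp. `m` frozen entries): NE4 is EQUIVALENT, given the memory companion, to its FROZEN-PREFIX form (hypothesis shape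
`FrozenShift φ γ β`, §2; converse `frozenShift_of_scaleShiftRate`).  The point of freezing a GROWING prefix: if the frozen-prefix
comparison obeys a bound of the form `a·Λ^{live}·θ₀^{frozen}` — a geometric GAIN `θ₀ < 1` per frozen step and an arbitrary finite
LOSS `Λ` per live step (§3) — then splitting each history in the proportion «p frozen : 1 live» with `Λ·θ₀^p ≤ ρ`, `ω ≤ ρ` gives
`ScaleShiftRate` at every rate `θ′` with `θ′^{p+1} ≥ ρ` (`scaleShiftRate_of_frozenShift_root`; half split `p = 1`:
`scaleShiftRate_of_frozenShift_half`, rate `√ρ`; existence of a rate `< 1` whenever `ω < 1 ∧ θ₀ < 1`, ANY `Λ`: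
`exists_scaleShiftRate_of_frozenShift`).  NO threshold couples the loss `Λ` to the memory rate `ω` — contrast the renewal
windows `(1 + C′)ω < ρ` of the flag road (`T4FlagMemory.ne4_of_scheme`) and of census (R3)∕(R5), which DERIVE the memory companion;
here it is GIVEN (node U2 consumes it anyway), and then NE4 costs no window at all.  RATE-FREE COUSIN (§4,
`shift_eventually_small_of_frozenShift`): if the frozen-prefix comparison merely CONVERGES (`φ k m = Λ^{k+1−m}·δ m`, `δ m → 0`, any `Λ`),
the two-depth shift vanishes UNIFORMLY on the boxes — the cutoff-forgetting WITHOUT rate that King's route consumes ((R51)), here from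
convergence along frozen histories only (contrast `Spine/NE4/KingCurrencyPointwise.lean`: Cauchy along every history, Arzelà–Ascoli).

READING (labelled heuristic; nothing of Bałaban's asserted).  Frozen at `ε → 0⁺` the prefix is the asymptotically free corner: the
first `m` renormalization steps at vanishing coupling, whose data are the free (Gaussian) objects at depth `m` — covariances and
propagators, which settle like `L^{−2m}` (rows NE2∕NE3; the tree's exact instances `Spine/NE4/BlockCovarianceRate.lean`,
`Spine/NE4/BalabanPhiAxisRate.lean`, and the NE2 lineage's `B5QGQ199Rate.phiMu_rate`); the live steps need only a k-uniform
Lipschitz dependence on their input with ANY constant — the currency of the Cauchy estimate on [Balaban1988RG2Cluster]'s analyticity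
polydiscs (census (R1)) — NOT an η-difference theory of the interacting step and NOT a contraction; the memory companion freezes the
old couplings.  The autonomous-road rendering (stability + settling of the frozen orbit ⇒ `FrozenShift` with gain and loss) is the
companion file `Spine/NE4/ScaleShiftFrozenOrbit.lean`.  The same split applies verbatim one level up (activities instead of β: NE5's
geometric rate GIVEN NE9's memory) — recorded as a pointer in `HOME/ne/NE4.md` §8, not typed here.  Rate-free cousin:
`Spine/NE4/KingCurrencyPointwise.shift_eventually_small_of_pointwise` (fixed frozen block, Arzelà–Ascoli, no rate); this file is
its quantitative form (growing frozen block, a rate).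

No status word moves: NE4 DEPENDENT (⇐ NE5 ∧ (AF-0r)); NOT IN PRINT; NOT PROVED; 0∕9.  HONEST DEPENDENCY (cell, verbatim): continuum
YM on T⁴ ⇐ BetaPertH ∧ nine spine estimates (0∕9 proved); BetaPertH ⇐ (D1) ∧ (D4) ∧ CAP+tail.

References (TYPES only): [Balaban1987RG1] = T. Bałaban, Commun. Math. Phys. **109** (1987) 249–301, (0.20) p. 256, p. 264, §5 p. 298;
[Balaban1988RG2Cluster] = CMP **116** (1988) 1–22, Lemma 3 (2.38) p. 20; C. King, CMP **102** (1986) Thm 3.4 (3.9) p. 656 (shape only).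
-/

noncomputable section

open Finset Filter Topology

namespace Summit.QuantumFields.BalabanUV.T4Continuum.Spine.NE4.ScaleShiftFrozenHistory

open Literature.MathematicalPhysics.QuantumFieldTheory.Balaban1983to89
open Literature.MathematicalPhysics.QuantumFieldTheory.Balaban1983to89.FlowStep
open T4CouplingMatching (ScaleShiftRate HistLipschitz FadingMemory)
open T4FlagMemory (extd extd_coe extd_adm extd_tail tail_mem_box Adm)

/-! ## §1 Freezing a prefix of a history: the slide paid by the memory companion -/

/-- The history `w` with its OLDEST `m` couplings (indices `< m`) FROZEN at the common value `ε`. [folklore] -/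
def frz {n : ℕ} (m : ℕ) (ε : ℝ) (w : Fin (n + 1) → ℝ) : Fin (n + 1) → ℝ :=
  fun i => if (i : ℕ) < m then ε else w i

/-- [bookkeeping] unfolding. [folklore] -/
theorem frz_apply {n : ℕ} (m : ℕ) (ε : ℝ) (w : Fin (n + 1) → ℝ) (i : Fin (n + 1)) :
    frz m ε w i = if (i : ℕ) < m then ε else w i := rfl

/-- [bookkeeping] freezing nothing. [folklore] -/
@[simp] theorem frz_zero {n : ℕ} (ε : ℝ) (w : Fin (n + 1) → ℝ) : frz 0 ε w = w := by
  funext i; simp [frz]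

/-- [bookkeeping] a frozen history stays in the box when `ε ∈ ]0,γ]`. [folklore] -/
theorem frz_mem_box {n m : ℕ} {γ ε : ℝ} {w : Fin (n + 1) → ℝ} (hε0 : 0 < ε) (hεγ : ε ≤ γ) (hw : w ∈ Box γ n) :
    frz m ε w ∈ Box γ n := by
  refine mem_box.mpr fun i => ?_
  by_cases h : (i : ℕ) < m
  · rw [frz_apply, if_pos h]; exact ⟨hε0, hεγ⟩
  · rw [frz_apply, if_neg h]; exact mem_box.mp hw i

/-- [bookkeeping] INDEX BOOKKEEPING OF THE TWO RUNS: dropping the finest coupling of a history with `m+1` frozen entries gives the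
tail with `m` frozen entries. [folklore] -/
theorem tail_frz {k : ℕ} (m : ℕ) (ε : ℝ) (w : Fin (k + 2) → ℝ) :
    Fin.tail (frz (m + 1) ε w) = frz m ε (Fin.tail w) := by
  funext i
  simp only [Fin.tail, frz_apply, Fin.val_succ]
  by_cases h : (i : ℕ) < m
  · rw [if_pos (Nat.succ_lt_succ h), if_pos h]
  · rw [if_neg (fun h' => h (Nat.lt_of_succ_lt_succ h')), if_neg h]

/-- [bookkeeping] on the prefix, the extension of a frozen history reads `ε` at the frozen indices. [folklore] -/
theorem extd_frz_of_lt {n m j : ℕ} (ε : ℝ) (w : Fin (n + 1) → ℝ) (hj : j < m) (hm : m ≤ n + 1) :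
    extd (frz m ε w) j = ε := by
  have hjn : j < n + 1 := lt_of_lt_of_le hj hm
  have e := extd_coe (frz m ε w) ⟨j, hjn⟩
  rw [Fin.val_mk] at e
  rw [e, frz_apply, if_pos hj]

/-- ONE ENTRY: under `HistLipschitz Λ γ β`, freezing one more coupling (index `m ≤ n`) of a history in the box costs at most
`Λ n m · γ` in `β_{n+1}` (`0 ≤ Λ n m`). [cite: Balaban1987RG1, §5 p.298] -/
theorem abs_sub_frz_succ_le {β : HBeta} {Λ : ℕ → ℕ → ℝ} {γ ε : ℝ} {n m : ℕ} {w : Fin (n + 1) → ℝ}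
    (hL : HistLipschitz Λ γ β) (hw : w ∈ Box γ n) (hε0 : 0 < ε) (hεγ : ε ≤ γ) (hm : m ≤ n) (hΛ0 : 0 ≤ Λ n m) :
    |β n (frz m ε w) - β n (frz (m + 1) ε w)| ≤ Λ n m * γ := by
  have hmn : m < n + 1 := Nat.lt_succ_of_le hm
  have h1 : frz m ε w ∈ Box γ n := frz_mem_box hε0 hεγ hw
  have h2 : frz (m + 1) ε w ∈ Box γ n := frz_mem_box hε0 hεγ hw
  have hLk := hL n _ _ h1 h2
  have hsum : ∑ i : Fin (n + 1), Λ n i * |frz m ε w i - frz (m + 1) ε w i|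
      = Λ n m * |w ⟨m, hmn⟩ - ε| := by
    rw [Finset.sum_eq_single ⟨m, hmn⟩]
    · simp [frz_apply]
    · intro i _ hi
      have hi' : (i : ℕ) ≠ m := fun h => hi (Fin.ext h)
      by_cases h : (i : ℕ) < m
      · rw [frz_apply, frz_apply, if_pos h, if_pos (Nat.lt_succ_of_lt h), sub_self, abs_zero, mul_zero]
      · have h' : ¬ (i : ℕ) < m + 1 := by omega
        rw [frz_apply, frz_apply, if_neg h, if_neg h', sub_self, abs_zero, mul_zero]
    · intro h; exact absurd (Finset.mem_univ _) h
  rw [hsum] at hLk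
  have hwm := (mem_box.mp hw) ⟨m, hmn⟩
  have hdist : |w ⟨m, hmn⟩ - ε| ≤ γ := by
    rw [abs_sub_le_iff]; constructor <;> linarith [hwm.1, hwm.2]
  exact hLk.trans (mul_le_mul_of_nonneg_left hdist hΛ0)

/-- **THE PREFIX SLIDE.**  Under `HistLipschitz Λ γ β` with `FadingMemory C ω Λ` (`C ≥ 0`, `0 ≤ ω < 1`, `γ > 0`), freezing the oldest
`m` couplings (`m ≤ n+1`) of a history `w ∈ ]0,γ]^{n+1}` at any `ε ∈ ]0,γ]` moves `β_{n+1}` by at most `C·γ·ω^{n+1−m}∕(1−ω)`: the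
frozen couplings have ages `≥ n+1−m`, their influences sum geometrically. [cite: Balaban1987RG1, §5 p.298] -/
theorem abs_sub_frz_le {β : HBeta} {Λ : ℕ → ℕ → ℝ} {γ C ω ε : ℝ} {n : ℕ} {w : Fin (n + 1) → ℝ}
    (hL : HistLipschitz Λ γ β) (hΛ : FadingMemory C ω Λ) (hC : 0 ≤ C) (hω0 : 0 ≤ ω) (hω1 : ω < 1) (hγ : 0 < γ)
    (hw : w ∈ Box γ n) (hε0 : 0 < ε) (hεγ : ε ≤ γ) :
    ∀ m, m ≤ n + 1 → |β n w - β n (frz m ε w)| ≤ C * γ * ω ^ (n + 1 - m) / (1 - ω)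
  | 0, _ => by
    rw [frz_zero, sub_self, abs_zero]
    have h1 : 0 < 1 - ω := by linarith
    positivity
  | m + 1, hm => by
    have hmn : m ≤ n := Nat.le_of_succ_le_succ hm
    have ih := abs_sub_frz_le hL hΛ hC hω0 hω1 hγ hw hε0 hεγ m (Nat.le_succ_of_le hmn)
    have hΛnm := hΛ n m hmn
    have hstep := abs_sub_frz_succ_le hL hw hε0 hεγ hmn hΛnm.1
    have h1 : 0 < 1 - ω := by linarith
    have e1 : n + 1 - m = (n - m) + 1 := by omega
    have e2 : n + 1 - (m + 1) = n - m := by omega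
    calc |β n w - β n (frz (m + 1) ε w)|
        ≤ |β n w - β n (frz m ε w)| + |β n (frz m ε w) - β n (frz (m + 1) ε w)| := abs_sub_le _ _ _
      _ ≤ C * γ * ω ^ (n + 1 - m) / (1 - ω) + C * ω ^ (n - m) * γ :=
          add_le_add ih (hstep.trans (mul_le_mul_of_nonneg_right hΛnm.2 hγ.le))
      _ = C * γ * ω ^ (n + 1 - (m + 1)) / (1 - ω) := by
          rw [e1, e2, pow_succ]
          field_simp
          ring

/-! ## §2 NE4 ⟺ its frozen-prefix form, given the memory companion -/

/-- **THE TWO-DEPTH SHIFT UP TO A FROZEN PREFIX.**  Under the memory companion (`HistLipschitz Λ γ β`, `FadingMemory C ω Λ`,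
`C ≥ 0`, `0 ≤ ω < 1`, `γ > 0`), for every history `w ∈ ]0,γ]^{k+2}`, every `m ≤ k+1` and every `ε ∈ ]0,γ]`:
`|β_{k+2}(w) − β_{k+1}(tail w)| ≤ 2·Cγω^{k+1−m}∕(1−ω) + |β_{k+2}(frz (m+1) ε w) − β_{k+1}(frz m ε (tail w))|` — NE4's comparison need
only be made on histories whose oldest `m+1` (resp. `m`) couplings are frozen at one value. [cite: Balaban1987RG1, (0.20) p.256 and §5 p.298] -/
theorem shift_le_frozen {β : HBeta} {Λ : ℕ → ℕ → ℝ} {γ C ω ε : ℝ} {k m : ℕ} {w : Fin (k + 2) → ℝ}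
    (hL : HistLipschitz Λ γ β) (hΛ : FadingMemory C ω Λ) (hC : 0 ≤ C) (hω0 : 0 ≤ ω) (hω1 : ω < 1) (hγ : 0 < γ)
    (hw : w ∈ Box γ (k + 1)) (hε0 : 0 < ε) (hεγ : ε ≤ γ) (hm : m ≤ k + 1) :
    |β (k + 1) w - β k (Fin.tail w)| ≤ 2 * (C * γ * ω ^ (k + 1 - m) / (1 - ω))
      + |β (k + 1) (frz (m + 1) ε w) - β k (frz m ε (Fin.tail w))| := by
  have hB := abs_sub_frz_le hL hΛ hC hω0 hω1 hγ hw hε0 hεγ (m + 1) (by omega)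
  have hA := abs_sub_frz_le hL hΛ hC hω0 hω1 hγ (tail_mem_box hw) hε0 hεγ m hm
  have e : k + 1 + 1 - (m + 1) = k + 1 - m := by omega
  rw [e] at hB
  rw [abs_sub_comm] at hA
  calc |β (k + 1) w - β k (Fin.tail w)|
      = |(β (k + 1) w - β (k + 1) (frz (m + 1) ε w))
          + (β (k + 1) (frz (m + 1) ε w) - β k (frz m ε (Fin.tail w)))
          + (β k (frz m ε (Fin.tail w)) - β k (Fin.tail w))| := by ring_nf
    _ ≤ |β (k + 1) w - β (k + 1) (frz (m + 1) ε w)|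
          + |β (k + 1) (frz (m + 1) ε w) - β k (frz m ε (Fin.tail w))|
          + |β k (frz m ε (Fin.tail w)) - β k (Fin.tail w)| := abs_add_three _ _ _
    _ ≤ C * γ * ω ^ (k + 1 - m) / (1 - ω)
          + |β (k + 1) (frz (m + 1) ε w) - β k (frz m ε (Fin.tail w))|
          + C * γ * ω ^ (k + 1 - m) / (1 - ω) := add_le_add (add_le_add hB le_rfl) hA
    _ = _ := by ring

/-- HYPOTHESIS SHAPE — NE4's comparison ON FROZEN-PREFIX HISTORIES ONLY, with an arbitrary two-parameter envelope `φ k m`: for every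
`k`, every `m ≤ k+1`, every history `w ∈ ]0,γ]^{k+2}` and every tolerance `η > 0` there is SOME freezing value `ε ∈ ]0,γ]` (e.g. only
along `ε → 0⁺`, the asymptotically free corner) with
`|β_{k+2}(frz (m+1) ε w) − β_{k+1}(frz m ε (tail w))| ≤ φ k m + η`.  An UNPRINTED input; NOT a fact. [cite: Balaban1987RG1, (0.20) p.256 and p.264] -/
def FrozenShift (φ : ℕ → ℕ → ℝ) (γ : ℝ) (β : HBeta) : Prop :=
  ∀ k m, m ≤ k + 1 → ∀ w : Fin (k + 2) → ℝ, w ∈ Box γ (k + 1) → ∀ η : ℝ, 0 < η →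
    ∃ ε : ℝ, 0 < ε ∧ ε ≤ γ ∧ |β (k + 1) (frz (m + 1) ε w) - β k (frz m ε (Fin.tail w))| ≤ φ k m + η

/-- **GENERAL ENVELOPES.**  `FrozenShift φ γ β` + the memory companion ⇒ ON THE WHOLE BOX, for every `m ≤ k+1`,
`|β_{k+2}(w) − β_{k+1}(tail w)| ≤ 2Cγω^{k+1−m}∕(1−ω) + φ k m`. [folklore] -/
theorem shiftEnvelope_of_frozenShift {β : HBeta} {Λ : ℕ → ℕ → ℝ} {γ C ω : ℝ} {φ : ℕ → ℕ → ℝ}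
    (hL : HistLipschitz Λ γ β) (hΛ : FadingMemory C ω Λ) (hC : 0 ≤ C) (hω0 : 0 ≤ ω) (hω1 : ω < 1) (hγ : 0 < γ)
    (hF : FrozenShift φ γ β) :
    ∀ k m, m ≤ k + 1 → ∀ w : Fin (k + 2) → ℝ, w ∈ Box γ (k + 1) →
      |β (k + 1) w - β k (Fin.tail w)| ≤ 2 * (C * γ * ω ^ (k + 1 - m) / (1 - ω)) + φ k m := by
  intro k m hm w hw
  refine le_of_forall_pos_le_add fun η hη => ?_
  obtain ⟨ε, hε0, hεγ, hφ⟩ := hF k m hm w hw η hη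
  have h := shift_le_frozen hL hΛ hC hω0 hω1 hγ hw hε0 hεγ hm
  linarith

/-- **THE CONVERSE** (trivial): `ScaleShiftRate c θ γ β` gives `FrozenShift (fun k _ ↦ c·θ^k) γ β` with `ε = γ` and `η` unused —
frozen histories lie in the box.  So, given the memory companion, NE4 and its frozen-prefix form are EQUIVALENT up to constants and
rates. [folklore] -/
theorem frozenShift_of_scaleShiftRate {β : HBeta} {γ c θ : ℝ} (hγ : 0 < γ) (hS : ScaleShiftRate c θ γ β) :
    FrozenShift (fun k _ => c * θ ^ k) γ β := by
  intro k m _ w hw η hη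
  refine ⟨γ, hγ, le_rfl, ?_⟩
  have h := hS k (frz (m + 1) γ w) (frz_mem_box hγ le_rfl hw)
  rw [tail_frz] at h
  linarith

/-! ## §3 Gain per frozen step, loss per live step: a rate with NO threshold -/

/-- **THE p : 1 SPLIT.**  Suppose the frozen-prefix comparison obeys `φ k m = a·Λ^{k+1−m}·θ₀^m` — a GAIN `θ₀ ∈ [0,1]` per frozen step
and a LOSS `Λ ≥ 0` (of any size) per live step — and the memory companion holds with rate `ω ∈ [0,1[`.  If `p : ℕ` and
`θ′ ∈ ]0,1]` satisfy `ω ≤ θ′^{p+1}` and `Λ·θ₀^p ≤ θ′^{p+1}`, then `ScaleShiftRate ((2Cγ∕(1−ω) + a) ∕ θ′^p) θ′ γ β`: split the `k+1`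
non-pinned positions as `t = ⌊(k+1)∕(p+1)⌋` live and `k+1−t ≥ p·t` frozen.  NO condition relates `Λ` to `ω`. [folklore] -/
theorem scaleShiftRate_of_frozenShift_root {β : HBeta} {Λm : ℕ → ℕ → ℝ} {γ C ω a Λ θ₀ θ' : ℝ} {p : ℕ}
    (hL : HistLipschitz Λm γ β) (hΛ : FadingMemory C ω Λm) (hC : 0 ≤ C) (hω0 : 0 ≤ ω) (hω1 : ω < 1) (hγ : 0 < γ)
    (ha : 0 ≤ a) (hΛ0 : 0 ≤ Λ) (hθ0 : 0 ≤ θ₀) (hθ1 : θ₀ ≤ 1)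
    (hθ'0 : 0 < θ') (hθ'1 : θ' ≤ 1) (hωθ' : ω ≤ θ' ^ (p + 1)) (hΛθ' : Λ * θ₀ ^ p ≤ θ' ^ (p + 1))
    (hF : FrozenShift (fun k m => a * Λ ^ (k + 1 - m) * θ₀ ^ m) γ β) :
    ScaleShiftRate ((2 * (C * γ / (1 - ω)) + a) / θ' ^ p) θ' γ β := by
  intro k w hw
  set t := (k + 1) / (p + 1) with ht
  have ht1 : (p + 1) * t ≤ k + 1 := Nat.mul_div_le (k + 1) (p + 1)
  have ht2 : k + 1 < (p + 1) * (t + 1) := Nat.lt_mul_div_succ (k + 1) (Nat.succ_pos p)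
  have htk : t ≤ k + 1 := Nat.div_le_self _ _
  have hlin1 : (p + 1) * (t + 1) = (p + 1) * t + (p + 1) := by ring
  have hlin2 : (p + 1) * t = p * t + t := by ring
  have hm : k + 1 - t ≤ k + 1 := Nat.sub_le _ _
  have henv := shiftEnvelope_of_frozenShift hL hΛ hC hω0 hω1 hγ hF k (k + 1 - t) hm w hw
  have e1 : k + 1 - (k + 1 - t) = t := by omega
  rw [e1] at henv
  have h1ω : 0 < 1 - ω := by linarith
  set ρ := θ' ^ (p + 1) with hρ
  have hρ0 : 0 ≤ ρ := pow_nonneg hθ'0.le _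
  -- both terms are ≤ (const)·ρ^t
  have hωt : ω ^ t ≤ ρ ^ t := pow_le_pow_left₀ hω0 hωθ' t
  have hpt : p * t ≤ k + 1 - t := by omega
  have hΛt : Λ ^ t * θ₀ ^ (k + 1 - t) ≤ ρ ^ t := by
    calc Λ ^ t * θ₀ ^ (k + 1 - t) ≤ Λ ^ t * θ₀ ^ (p * t) :=
          mul_le_mul_of_nonneg_left (pow_le_pow_of_le_one hθ0 hθ1 hpt) (pow_nonneg hΛ0 _)
      _ = (Λ * θ₀ ^ p) ^ t := by rw [mul_pow, ← pow_mul]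
      _ ≤ ρ ^ t := pow_le_pow_left₀ (mul_nonneg hΛ0 (pow_nonneg hθ0 _)) hΛθ' t
  -- ρ^t = θ'^((p+1)t) ≤ θ'^(k+1-p)·… ≤ θ'^k / θ'^p
  have hρt : ρ ^ t ≤ θ' ^ k / θ' ^ p := by
    have hθ'p : 0 < θ' ^ p := pow_pos hθ'0 p
    rw [le_div_iff₀ hθ'p, hρ, ← pow_mul, ← pow_add]
    exact pow_le_pow_of_le_one hθ'0.le hθ'1 (by omega)
  have hK : 0 ≤ 2 * (C * γ / (1 - ω)) + a := by positivity
  calc |β (k + 1) w - β k (Fin.tail w)|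
      ≤ 2 * (C * γ * ω ^ t / (1 - ω)) + a * Λ ^ t * θ₀ ^ (k + 1 - t) := henv
    _ = 2 * (C * γ / (1 - ω)) * ω ^ t + a * (Λ ^ t * θ₀ ^ (k + 1 - t)) := by
        field_simp
    _ ≤ 2 * (C * γ / (1 - ω)) * ρ ^ t + a * ρ ^ t :=
        add_le_add (mul_le_mul_of_nonneg_left hωt (by positivity)) (mul_le_mul_of_nonneg_left hΛt ha)
    _ = (2 * (C * γ / (1 - ω)) + a) * ρ ^ t := by ring
    _ ≤ (2 * (C * γ / (1 - ω)) + a) * (θ' ^ k / θ' ^ p) := mul_le_mul_of_nonneg_left hρt hK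
    _ = (2 * (C * γ / (1 - ω)) + a) / θ' ^ p * θ' ^ k := by ring

/-- **THE HALF SPLIT** (`p = 1`, no loss of constant): if `ω ≤ ρ`, `Λ·θ₀ ≤ ρ` and `ρ ≤ 1`, then
`ScaleShiftRate (2Cγ∕(1−ω) + a) (√ρ) γ β` — half of each history frozen, half live; rate `< 1` as soon as `ω < 1` and `Λ·θ₀ < 1`
(loss per live step below the reciprocal gain per frozen step). [folklore] -/
theorem scaleShiftRate_of_frozenShift_half {β : HBeta} {Λm : ℕ → ℕ → ℝ} {γ C ω a Λ θ₀ ρ : ℝ}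
    (hL : HistLipschitz Λm γ β) (hΛ : FadingMemory C ω Λm) (hC : 0 ≤ C) (hω0 : 0 ≤ ω) (hω1 : ω < 1) (hγ : 0 < γ)
    (ha : 0 ≤ a) (hΛ0 : 0 ≤ Λ) (hθ0 : 0 ≤ θ₀) (hθ1 : θ₀ ≤ 1)
    (hωρ : ω ≤ ρ) (hΛρ : Λ * θ₀ ≤ ρ) (hρ1 : ρ ≤ 1)
    (hF : FrozenShift (fun k m => a * Λ ^ (k + 1 - m) * θ₀ ^ m) γ β) :
    ScaleShiftRate (2 * (C * γ / (1 - ω)) + a) (Real.sqrt ρ) γ β := by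
  intro k w hw
  set t := (k + 1) / 2 with ht
  have ht1 : 2 * t ≤ k + 1 := Nat.mul_div_le (k + 1) 2
  have ht2 : k ≤ 2 * t := by omega
  have htk : t ≤ k + 1 := Nat.div_le_self _ _
  have hm : k + 1 - t ≤ k + 1 := Nat.sub_le _ _
  have henv := shiftEnvelope_of_frozenShift hL hΛ hC hω0 hω1 hγ hF k (k + 1 - t) hm w hw
  have e1 : k + 1 - (k + 1 - t) = t := by omega
  rw [e1] at henv
  have h1ω : 0 < 1 - ω := by linarith
  have hρ0 : 0 ≤ ρ := hω0.trans hωρ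
  have hωt : ω ^ t ≤ ρ ^ t := pow_le_pow_left₀ hω0 hωρ t
  have htt : t ≤ k + 1 - t := by omega
  have hΛt : Λ ^ t * θ₀ ^ (k + 1 - t) ≤ ρ ^ t := by
    calc Λ ^ t * θ₀ ^ (k + 1 - t) ≤ Λ ^ t * θ₀ ^ t :=
          mul_le_mul_of_nonneg_left (pow_le_pow_of_le_one hθ0 hθ1 htt) (pow_nonneg hΛ0 _)
      _ = (Λ * θ₀) ^ t := (mul_pow _ _ _).symm
      _ ≤ ρ ^ t := pow_le_pow_left₀ (mul_nonneg hΛ0 hθ0) hΛρ t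
  have hsq : ρ ^ t ≤ Real.sqrt ρ ^ k := by
    have h1 : Real.sqrt ρ ^ (2 * t) = ρ ^ t := by rw [pow_mul, Real.sq_sqrt hρ0]
    rw [← h1]
    have hs1 : Real.sqrt ρ ≤ 1 := by simpa using Real.sqrt_le_sqrt hρ1
    exact pow_le_pow_of_le_one (Real.sqrt_nonneg _) hs1 ht2
  have hK : 0 ≤ 2 * (C * γ / (1 - ω)) + a := by positivity
  calc |β (k + 1) w - β k (Fin.tail w)|
      ≤ 2 * (C * γ * ω ^ t / (1 - ω)) + a * Λ ^ t * θ₀ ^ (k + 1 - t) := henv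
    _ = 2 * (C * γ / (1 - ω)) * ω ^ t + a * (Λ ^ t * θ₀ ^ (k + 1 - t)) := by
        field_simp
    _ ≤ 2 * (C * γ / (1 - ω)) * ρ ^ t + a * ρ ^ t :=
        add_le_add (mul_le_mul_of_nonneg_left hωt (by positivity)) (mul_le_mul_of_nonneg_left hΛt ha)
    _ = (2 * (C * γ / (1 - ω)) + a) * ρ ^ t := by ring
    _ ≤ (2 * (C * γ / (1 - ω)) + a) * Real.sqrt ρ ^ k := mul_le_mul_of_nonneg_left hsq hK

/-- **A RATE BELOW ONE FOR EVERY FINITE LOSS.**  Memory companion with `ω < 1` + a frozen-prefix bound with gain `θ₀ < 1` and ANY loss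
`Λ ≥ 0` ⇒ `∃ c′ ≥ 0, ∃ θ′ ∈ [0,1[, ScaleShiftRate c′ θ′ γ β` (choose `p` with `Λ·θ₀^p < 1`, then `θ′ = ρ^{1∕(p+1)}`).  The threshold-free
statement of this file. [folklore] -/
theorem exists_scaleShiftRate_of_frozenShift {β : HBeta} {Λm : ℕ → ℕ → ℝ} {γ C ω a Λ θ₀ : ℝ}
    (hL : HistLipschitz Λm γ β) (hΛ : FadingMemory C ω Λm) (hC : 0 ≤ C) (hω0 : 0 ≤ ω) (hω1 : ω < 1) (hγ : 0 < γ)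
    (ha : 0 ≤ a) (hΛ0 : 0 ≤ Λ) (hθ0 : 0 ≤ θ₀) (hθ1 : θ₀ < 1)
    (hF : FrozenShift (fun k m => a * Λ ^ (k + 1 - m) * θ₀ ^ m) γ β) :
    ∃ c' θ' : ℝ, 0 ≤ c' ∧ 0 ≤ θ' ∧ θ' < 1 ∧ ScaleShiftRate c' θ' γ β := by
  -- a block length p with Λ θ₀^p < 1 : use θ₀^p → 0
  obtain ⟨p, hp⟩ : ∃ p : ℕ, θ₀ ^ p < 1 / (Λ + 1) := exists_pow_lt_of_lt_one (by positivity) hθ1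
  have hΛp : Λ * θ₀ ^ p < 1 := by
    have hΛ1 : 0 < Λ + 1 := by linarith
    calc Λ * θ₀ ^ p ≤ (Λ + 1) * θ₀ ^ p := mul_le_mul_of_nonneg_right (by linarith) (pow_nonneg hθ0 _)
      _ < (Λ + 1) * (1 / (Λ + 1)) := mul_lt_mul_of_pos_left hp hΛ1
      _ = 1 := by field_simp
  -- ρ ∈ [1/2, 1[ dominating ω and Λ θ₀^p
  set ρ := max (max ω (Λ * θ₀ ^ p)) (1 / 2) with hρ
  have hρpos : 0 < ρ := lt_of_lt_of_le (by norm_num) (le_max_right _ _)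
  have hρ1 : ρ < 1 := max_lt (max_lt hω1 hΛp) (by norm_num)
  have hωρ : ω ≤ ρ := (le_max_left _ _).trans (le_max_left _ _)
  have hΛρ : Λ * θ₀ ^ p ≤ ρ := (le_max_right _ _).trans (le_max_left _ _)
  -- θ' = ρ^(1/(p+1))
  set θ' : ℝ := ρ ^ ((1 : ℝ) / (p + 1)) with hθ'
  have hexp : 0 < (1 : ℝ) / (p + 1) := by positivity
  have hθ'0 : 0 < θ' := Real.rpow_pos_of_pos hρpos _
  have hθ'1 : θ' < 1 := Real.rpow_lt_one hρpos.le hρ1 hexp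
  have hpow : θ' ^ (p + 1) = ρ := by
    rw [hθ', ← Real.rpow_natCast, ← Real.rpow_mul hρpos.le]
    have : (1 : ℝ) / (p + 1) * ((p + 1 : ℕ) : ℝ) = 1 := by
      rw [Nat.cast_add_one]; field_simp
    rw [this, Real.rpow_one]
  have h1ω : 0 < 1 - ω := by linarith
  refine ⟨(2 * (C * γ / (1 - ω)) + a) / θ' ^ p, θ', by positivity, hθ'0.le, hθ'1, ?_⟩
  exact scaleShiftRate_of_frozenShift_root hL hΛ hC hω0 hω1 hγ ha hΛ0 hθ0 hθ1.le hθ'0 hθ'1.le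
    (hωρ.trans hpow.symm.le) (hΛρ.trans hpow.symm.le) hF

/-! ## §4 The rate-free cousin: frozen-prefix CONVERGENCE with bounded live amplification ⇒ the shift vanishes uniformly -/

/-- **NO RATE NEEDED IN KING's CURRENCY.**  If the memory companion holds (rate `ω < 1`) and the frozen-prefix comparison obeys
`φ k m = Λ^{k+1−m}·δ m` with `δ m → 0` — the frozen ∕ free orbit merely CONVERGES, no rate — and ANY `Λ ≥ 0`, then NE4's two-depth shift
vanishes UNIFORMLY on the boxes: `∀ η > 0, ∃ k₀, ∀ k ≥ k₀, ∀ w ∈ ]0,γ]^{k+2}, |β_{k+2}(w) − β_{k+1}(tail w)| ≤ η` — the one-step instance of the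
rate-free cutoff-forgetting that King's route consumes ((R51), `Spine/NE4/KingCurrency.lean`), here from convergence along FROZEN histories only
and stability (contrast `Spine/NE4/KingCurrencyPointwise.shift_eventually_small_of_pointwise`: Cauchy along EVERY history, by Arzelà–Ascoli).
Fix the live count `n` with `2Cγω^n∕(1−ω) < η∕2`, then take `k` so large that `Λ^n·δ(k+1−n) < η∕2`. [folklore] -/
theorem shift_eventually_small_of_frozenShift {β : HBeta} {Λm : ℕ → ℕ → ℝ} {γ C ω Λ : ℝ} {δ : ℕ → ℝ}
    (hL : HistLipschitz Λm γ β) (hΛ : FadingMemory C ω Λm) (hC : 0 ≤ C) (hω0 : 0 ≤ ω) (hω1 : ω < 1) (hγ : 0 < γ)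
    (hδ : Tendsto δ atTop (𝓝 0))
    (hF : FrozenShift (fun k m => Λ ^ (k + 1 - m) * δ m) γ β) :
    ∀ η : ℝ, 0 < η → ∃ k₀ : ℕ, ∀ k, k₀ ≤ k → ∀ w : Fin (k + 2) → ℝ, w ∈ Box γ (k + 1) →
      |β (k + 1) w - β k (Fin.tail w)| ≤ η := by
  intro η hη
  have h1ω : 0 < 1 - ω := by linarith
  have hωn : Tendsto (fun n : ℕ => 2 * (C * γ * ω ^ n / (1 - ω))) atTop (𝓝 (2 * (C * γ * 0 / (1 - ω)))) :=
    ((((tendsto_pow_atTop_nhds_zero_of_lt_one hω0 hω1).const_mul (C * γ)).div_const (1 - ω)).const_mul 2)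
  rw [mul_zero, zero_div, mul_zero] at hωn
  obtain ⟨n, hn⟩ := (hωn.eventually (gt_mem_nhds (half_pos hη))).exists
  have hδn : Tendsto (fun m => Λ ^ n * δ m) atTop (𝓝 (Λ ^ n * 0)) := hδ.const_mul _
  rw [mul_zero] at hδn
  obtain ⟨m₀, hm₀⟩ := (hδn.eventually (gt_mem_nhds (half_pos hη))).exists_forall_of_atTop
  refine ⟨m₀ + n, fun k hk w hw => ?_⟩
  have hm : k + 1 - n ≤ k + 1 := Nat.sub_le _ _
  have henv := shiftEnvelope_of_frozenShift hL hΛ hC hω0 hω1 hγ hF k (k + 1 - n) hm w hw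
  have e1 : k + 1 - (k + 1 - n) = n := by omega
  rw [e1] at henv
  have hδm := hm₀ (k + 1 - n) (by omega)
  linarith

/-! ## §5 (v1.1, appended) NE4 itself is the no-loss case of the gain∕loss bound -/

/-- **NE4 IS THE CASE `Λ = 1`, `θ₀ = θ` OF THE FROZEN-PREFIX GAIN∕LOSS BOUND.**  `ScaleShiftRate c θ γ β` with `0 < θ ≤ 1`, `0 ≤ c`
gives `FrozenShift (fun k m ↦ (c∕θ)·1^{k+1−m}·θ^m) γ β` (no loss per live step, gain `θ` per frozen step, constant `c∕θ`): since
`c·θ^k ≤ (c∕θ)·θ^m` for every `m ≤ k+1`.  With `frozenShift_of_scaleShiftRate` and `scaleShiftRate_of_frozenShift_root` this closes the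
circle in the gain∕loss currency: GIVEN the memory companion, NE4 ⟺ «frozen-prefix gain θ₀ < 1 with SOME finite live loss Λ», the rate
moving between `θ` and the `θ′` of §3. [folklore] -/
theorem frozenShift_gainLoss_of_scaleShiftRate {β : HBeta} {γ c θ : ℝ} (hγ : 0 < γ) (hc : 0 ≤ c) (hθ0 : 0 < θ) (hθ1 : θ ≤ 1)
    (hS : ScaleShiftRate c θ γ β) :
    FrozenShift (fun k m => c / θ * (1 : ℝ) ^ (k + 1 - m) * θ ^ m) γ β := by
  intro k m hm w hw η hη
  obtain ⟨ε, hε0, hεγ, h⟩ := frozenShift_of_scaleShiftRate hγ hS k m hm w hw η hη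
  refine ⟨ε, hε0, hεγ, h.trans (add_le_add ?_ le_rfl)⟩
  show c * θ ^ k ≤ c / θ * (1 : ℝ) ^ (k + 1 - m) * θ ^ m
  rw [one_pow, mul_one]
  have hkm : θ ^ (k + 1) ≤ θ ^ m := pow_le_pow_of_le_one hθ0.le hθ1 hm
  calc c * θ ^ k = c / θ * θ ^ (k + 1) := by rw [pow_succ]; field_simp
    _ ≤ c / θ * θ ^ m := mul_le_mul_of_nonneg_left hkm (div_nonneg hc hθ0.le)

end Summit.QuantumFields.BalabanUV.T4Continuum.Spine.NE4.ScaleShiftFrozenHistory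

end
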